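import Mathlib
import Literature.NumberTheory.LFunctions.Zhang2022.TypedSection15CRel
import Literature.NumberTheory.LFunctions.Zhang2022.Section15U056RateRp
import HarnessLib

/-!
# Zhang (2022) §15 p. 88: the u056 → (15.23) → (15.24) chain over the RELATIVE u055 (`Step15_u055Rel`)

Topic `Literature/NumberTheory/LFunctions/Zhang2022` (Landau–Siegel audit tree; verdict-neutral).
Y. Zhang, *Discrete mean estimates and the Landau–Siegel zero*, arXiv:2211.02515v1 (2022)
[Zhang2022LandauSiegel] — an unrefereed manuscript under adjudication; nothing here asserts or denies
its Theorems 1–2. Fourth twin of `Section15U056Rate` / `…RateR` / `…RateRp` (lane ZHANG-L, WP15): the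
u055 input enters in the relative reading `Typed.Section15C.Step15_u055Rel`
(`‖Σ_{n<T} − L′(1,χ)²U(1)‖ ≤ C·α𝓛^{1.1}·((1+|L′(1,χ)|)²‖U(1)‖ + 1)`, file `TypedSection15CRel`), and the
chain still closes at the rate `O(1/𝓛)` because `‖L′(1,χ)‖ ≤ 4e^{9/2}𝓛²`
(`Lemma31.norm_deriv_LFunction_le_near_one`), `‖U(1)‖ ≤ 1 + |C₃|π` (u053R + `‖eulerU1‖ ≤ 1`) and
`α𝓛^{1.1} = π𝓛^{−7.9}`: `u056_rate1_of_exists_calU1R_rel`, `u056_rate1_of_partsRel` (the one-for-one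
twin of `u056_rate1_of_partsRp` for the skeleton swap `h15u055R ↦ h15u055Rel`), `eq15_23R_of_partsRel`,
`ded1524_of_displays_Rel`; and `Typed.Section15C.step15_u055Rel_of_R` (the typed absolute reading
implies the relative one). Theorems only. WHAT THIS IS NOT: a proof of u055 in either reading, nor any
claim about Theorems 1–2 of the manuscript or Landau–Siegel zeros.

## References
* Y. Zhang, arXiv:2211.02515v1 (2022), §15 pp. 87–88. [cite: Zhang2022LandauSiegel, §15 p.88]
-/

noncomputable section

open Complex Real ComplexConjugate Filter
open Literature.NumberTheory.LFunctions.Zhang2022.Skeleton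
open Literature.NumberTheory.LFunctions.Zhang2022.Typed

namespace Literature.NumberTheory.LFunctions.Zhang2022.Typed.Section15C

variable (c' : ℝ) (X : Inputs15AB)

/-- The typed (absolute) `Step15_u055R` implies the relative reading (`α𝓛 ≤ α𝓛^{1.1}·(… + 1)` for
`𝓛 ≥ 1`). [cite: Zhang2022LandauSiegel, §15 p.87] -/
theorem step15_u055Rel_of_R (h : Step15_u055R c' X) : Step15_u055Rel c' X := by
  obtain ⟨C, D₀, hC⟩ := h
  refine ⟨max C 0, max D₀ 3, fun D _ χ hD hq hp hA j hj U hU => ?_⟩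
  have h1 := hC D χ (le_trans (le_max_left _ _) hD) hq hp hA j hj U hU
  have hℓ : 1 ≤ ell D := one_le_ell (le_trans (le_max_right _ _) hD)
  have hα : 0 ≤ alpha D := alpha_nonneg D
  have hpow : ell D ≤ ell D ^ (1.1 : ℝ) := by
    calc ell D = ell D ^ (1 : ℝ) := (Real.rpow_one _).symm
      _ ≤ ell D ^ (1.1 : ℝ) := Real.rpow_le_rpow_of_exponent_le hℓ (by norm_num)
  have hX : (1 : ℝ) ≤ (1 + ‖deriv χ.LFunction 1‖) ^ 2 * ‖U 1‖ + 1 := by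
    have : 0 ≤ (1 + ‖deriv χ.LFunction 1‖) ^ 2 * ‖U 1‖ := by positivity
    linarith
  refine h1.trans ?_
  have hαℓ11 : 0 ≤ alpha D * ell D ^ (1.1 : ℝ) :=
    mul_nonneg hα (Real.rpow_nonneg (le_trans zero_le_one hℓ) _)
  calc C * (alpha D * ell D) ≤ max C 0 * (alpha D * ell D) :=
        mul_le_mul_of_nonneg_right (le_max_left _ _) (by positivity)
    _ ≤ max C 0 * (alpha D * ell D ^ (1.1 : ℝ)) :=
        mul_le_mul_of_nonneg_left (mul_le_mul_of_nonneg_left hpow hα) (le_max_right _ _)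
    _ = max C 0 * (alpha D * ell D ^ (1.1 : ℝ)) * 1 := (mul_one _).symm
    _ ≤ max C 0 * (alpha D * ell D ^ (1.1 : ℝ)) *
          ((1 + ‖deriv χ.LFunction 1‖) ^ 2 * ‖U 1‖ + 1) :=
        mul_le_mul_of_nonneg_left hX (mul_nonneg (le_max_right _ _) hαℓ11)

end Literature.NumberTheory.LFunctions.Zhang2022.Typed.Section15C

namespace Literature.NumberTheory.LFunctions.Zhang2022.Ded1524

/-- `log D ≥ M` once `D ≥ ⌈e^M⌉`. [folklore] -/
private theorem le_ell_of_ceil_exp_le₆ {M : ℝ} {D : ℕ} (hD : ⌈Real.exp M⌉₊ ≤ D) : M ≤ ell D := by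
  have h : Real.exp M ≤ D := le_trans (Nat.le_ceil _) (by exact_mod_cast hD)
  exact (Real.le_log_iff_exp_le (lt_of_lt_of_le (Real.exp_pos _) h)).mpr h

/-- `‖φ(D)²/D²‖ ≤ 1`. [folklore] -/
private theorem norm_totient_sq_div_sq_le_one' (D : ℕ) [NeZero D] :
    ‖(Nat.totient D : ℂ) ^ 2 / (D : ℂ) ^ 2‖ ≤ 1 := by
  have hD0 : 0 < (D : ℝ) := by exact_mod_cast Nat.pos_of_ne_zero (NeZero.ne D)
  have hφ : (Nat.totient D : ℝ) ≤ D := by exact_mod_cast Nat.totient_le D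
  rw [norm_div, norm_pow, norm_pow, Complex.norm_natCast, Complex.norm_natCast,
    div_le_one (by positivity)]
  exact pow_le_pow_left₀ (Nat.cast_nonneg _) hφ 2

/-- Bookkeeping for `‖U(1)‖`: `‖U₁ − P·e_U‖ ≤ C₃a`, `0 ≤ a ≤ π`, `‖P‖, ‖e_U‖ ≤ 1` ⇒ `‖U₁‖ ≤ 1 + |C₃|π`.
[cite: Zhang2022LandauSiegel, §15 Lemma 15.3 p.87] -/
private theorem norm_U1_le' {U₁ P eU : ℂ} {C₃ a : ℝ} (h : ‖U₁ - P * eU‖ ≤ C₃ * a) (ha0 : 0 ≤ a)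
    (haπ : a ≤ π) (hP : ‖P‖ ≤ 1) (heU : ‖eU‖ ≤ 1) : ‖U₁‖ ≤ 1 + |C₃| * π := by
  have h1 : ‖P * eU‖ ≤ 1 := by
    rw [norm_mul]
    calc ‖P‖ * ‖eU‖ ≤ 1 * 1 := mul_le_mul hP heU (norm_nonneg _) zero_le_one
      _ = 1 := one_mul _
  have h2 : C₃ * a ≤ |C₃| * π :=
    (mul_le_mul_of_nonneg_right (le_abs_self C₃) ha0).trans
      (mul_le_mul_of_nonneg_left haπ (abs_nonneg _))
  calc ‖U₁‖ = ‖(U₁ - P * eU) + P * eU‖ := by rw [sub_add_cancel]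
    _ ≤ ‖U₁ - P * eU‖ + ‖P * eU‖ := norm_add_le _ _
    _ ≤ |C₃| * π + 1 := add_le_add (h.trans h2) h1
    _ = 1 + |C₃| * π := by ring

/-- The arithmetic of the relative u055 error: with `α = π/𝓛⁹`, `𝓛 ≥ 1`, `L ≤ 4e^{9/2}𝓛²`,
`U ≤ C₂`: `|C₆|·(|C₄|·α𝓛^{1.1}·((1+L)²U + 1)) ≤ |C₆||C₄|π((1+4e^{9/2})²C₂ + 1)·(1/𝓛)`. [folklore] -/
private theorem relErr_le {ℓ α L U C₂ C₄ C₆ : ℝ} (hℓ1 : 1 ≤ ℓ) (hα : α = π / ℓ ^ 9)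
    (hL : L ≤ 4 * Real.exp (9 / 2) * ℓ ^ 2) (hL0 : 0 ≤ L) (hU : U ≤ C₂) (hU0 : 0 ≤ U) :
    |C₆| * (|C₄| * (α * ℓ ^ (1.1 : ℝ)) * ((1 + L) ^ 2 * U + 1)) ≤
      |C₆| * |C₄| * π * ((1 + 4 * Real.exp (9 / 2)) ^ 2 * C₂ + 1) * (1 / ℓ) := by
  have hℓ0 : 0 < ℓ := lt_of_lt_of_le zero_lt_one hℓ1
  have hC₂ : 0 ≤ C₂ := hU0.trans hU
  have hℓ2 : (1 : ℝ) ≤ ℓ ^ 2 := one_le_pow₀ hℓ1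
  have hℓ4 : (1 : ℝ) ≤ ℓ ^ 4 := one_le_pow₀ hℓ1
  have hL1 : 1 + L ≤ (1 + 4 * Real.exp (9 / 2)) * ℓ ^ 2 := by
    calc 1 + L ≤ ℓ ^ 2 + 4 * Real.exp (9 / 2) * ℓ ^ 2 := add_le_add hℓ2 hL
      _ = (1 + 4 * Real.exp (9 / 2)) * ℓ ^ 2 := by ring
  have h1 : (1 + L) ^ 2 ≤ (1 + 4 * Real.exp (9 / 2)) ^ 2 * ℓ ^ 4 := by
    calc (1 + L) ^ 2 ≤ ((1 + 4 * Real.exp (9 / 2)) * ℓ ^ 2) ^ 2 :=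
          pow_le_pow_left₀ (by linarith) hL1 2
      _ = (1 + 4 * Real.exp (9 / 2)) ^ 2 * ℓ ^ 4 := by ring
  have hX : (1 + L) ^ 2 * U + 1 ≤ ((1 + 4 * Real.exp (9 / 2)) ^ 2 * C₂ + 1) * ℓ ^ 4 := by
    have h2 : (1 + L) ^ 2 * U ≤ (1 + 4 * Real.exp (9 / 2)) ^ 2 * ℓ ^ 4 * C₂ :=
      mul_le_mul h1 hU hU0 (by positivity)
    calc (1 + L) ^ 2 * U + 1 ≤ (1 + 4 * Real.exp (9 / 2)) ^ 2 * ℓ ^ 4 * C₂ + ℓ ^ 4 :=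
          add_le_add h2 hℓ4
      _ = ((1 + 4 * Real.exp (9 / 2)) ^ 2 * C₂ + 1) * ℓ ^ 4 := by ring
  have hpow : ℓ ^ (1.1 : ℝ) ≤ ℓ ^ 4 := by
    calc ℓ ^ (1.1 : ℝ) ≤ ℓ ^ (4 : ℝ) := Real.rpow_le_rpow_of_exponent_le hℓ1 (by norm_num)
      _ = ℓ ^ 4 := by norm_cast
  have hαpos : 0 < α := by rw [hα]; positivity
  have hcore : α * ℓ ^ (1.1 : ℝ) * ℓ ^ 4 ≤ π * (1 / ℓ) := by
    have e : α * ℓ ^ 4 * ℓ ^ 4 = π * (1 / ℓ) := by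
      rw [hα]; field_simp
    calc α * ℓ ^ (1.1 : ℝ) * ℓ ^ 4 ≤ α * ℓ ^ 4 * ℓ ^ 4 :=
          mul_le_mul_of_nonneg_right (mul_le_mul_of_nonneg_left hpow hαpos.le) (by positivity)
      _ = π * (1 / ℓ) := e
  have hαℓ : 0 ≤ α * ℓ ^ (1.1 : ℝ) := mul_nonneg hαpos.le (Real.rpow_nonneg hℓ0.le _)
  calc |C₆| * (|C₄| * (α * ℓ ^ (1.1 : ℝ)) * ((1 + L) ^ 2 * U + 1))
      ≤ |C₆| * (|C₄| * (α * ℓ ^ (1.1 : ℝ)) * (((1 + 4 * Real.exp (9 / 2)) ^ 2 * C₂ + 1) * ℓ ^ 4)) :=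
        mul_le_mul_of_nonneg_left (mul_le_mul_of_nonneg_left hX (mul_nonneg (abs_nonneg _) hαℓ))
          (abs_nonneg _)
    _ = |C₆| * |C₄| * ((1 + 4 * Real.exp (9 / 2)) ^ 2 * C₂ + 1) * (α * ℓ ^ (1.1 : ℝ) * ℓ ^ 4) := by
        ring
    _ ≤ |C₆| * |C₄| * ((1 + 4 * Real.exp (9 / 2)) ^ 2 * C₂ + 1) * (π * (1 / ℓ)) :=
        mul_le_mul_of_nonneg_left hcore (by positivity)
    _ = |C₆| * |C₄| * π * ((1 + 4 * Real.exp (9 / 2)) ^ 2 * C₂ + 1) * (1 / ℓ) := by ring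

/-- The arithmetic of the Lemma 15.2 / u053 error terms (verbatim from `u056_rate1_of_exists_calU1R`):
with `α𝓛 = π/𝓛⁸ ≤ π`, `(4e^{9/2}𝓛²)²·(|C₆||C₃|α𝓛 + |C₁|α𝓛(C₂ + |C₃|α𝓛)) ≤ (4e^{9/2})²π(…)·(1/𝓛)`. [folklore] -/
private theorem t3_le {ℓ a C₁ C₂ C₃ C₆ : ℝ} (hℓ1 : 1 ≤ ℓ) (ha1 : a = π / ℓ ^ 8) (haπ : a ≤ π)
    (ha0 : 0 ≤ a) (hC₂0 : 0 ≤ C₂) :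
    (4 * Real.exp (9 / 2) * ℓ ^ 2) ^ 2 *
        (|C₆| * (|C₃| * a) + |C₁| * a * (C₂ + |C₃| * a)) ≤
      (4 * Real.exp (9 / 2)) ^ 2 * π * (|C₆| * |C₃| + |C₁| * (C₂ + |C₃| * π)) * (1 / ℓ) := by
  have hℓ0 : 0 < ℓ := lt_of_lt_of_le zero_lt_one hℓ1
  have h4 : ℓ ^ 4 * a = π * (1 / ℓ ^ 4) := by rw [ha1]; field_simp
  have i4 : 1 / ℓ ^ 4 ≤ 1 / ℓ :=
    one_div_le_one_div_of_le hℓ0 (by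
      calc ℓ = ℓ ^ 1 := (pow_one _).symm
        _ ≤ ℓ ^ 4 := pow_le_pow_right₀ hℓ1 (by norm_num))
  have inner : |C₆| * (|C₃| * a) + |C₁| * a * (C₂ + |C₃| * a) ≤
      (|C₆| * |C₃| + |C₁| * (C₂ + |C₃| * π)) * a := by
    have : |C₁| * a * (|C₃| * a) ≤ |C₁| * a * (|C₃| * π) := by gcongr
    nlinarith [abs_nonneg C₆, abs_nonneg C₃, abs_nonneg C₁, hC₂0]
  calc (4 * Real.exp (9 / 2) * ℓ ^ 2) ^ 2 * (|C₆| * (|C₃| * a) + |C₁| * a * (C₂ + |C₃| * a))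
      ≤ (4 * Real.exp (9 / 2) * ℓ ^ 2) ^ 2 * ((|C₆| * |C₃| + |C₁| * (C₂ + |C₃| * π)) * a) := by
        gcongr
    _ = (4 * Real.exp (9 / 2)) ^ 2 * (|C₆| * |C₃| + |C₁| * (C₂ + |C₃| * π)) * (ℓ ^ 4 * a) := by
        ring
    _ = (4 * Real.exp (9 / 2)) ^ 2 * (|C₆| * |C₃| + |C₁| * (C₂ + |C₃| * π)) * (π * (1 / ℓ ^ 4)) := by
        rw [h4]
    _ = (4 * Real.exp (9 / 2)) ^ 2 * π * (|C₆| * |C₃| + |C₁| * (C₂ + |C₃| * π)) * (1 / ℓ ^ 4) := by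
        ring
    _ ≤ (4 * Real.exp (9 / 2)) ^ 2 * π * (|C₆| * |C₃| + |C₁| * (C₂ + |C₃| * π)) * (1 / ℓ) := by
        gcongr

/-- **u056 at the rate `O(1/𝓛)` from the RELATIVE u055** (`Step15_u055Rel`) — twin of
`u056_rate1_of_exists_calU1R`: the only change is the u055 error
`ε₄ = |C₄|·α𝓛^{1.1}·((1+|L′(1,χ)|)²‖U(1)‖ + 1)`, which with `‖L′(1,χ)‖ ≤ 4e^{9/2}𝓛²`
(`Lemma31.norm_deriv_LFunction_le_near_one`), `‖U(1)‖ ≤ 1 + |C₃|π` (u053R) and `α𝓛^{1.1} = π𝓛^{−7.9}`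
is `≤ K₄/𝓛`. Original display (§15 p.88, tex L4363–L4365):
`𝓜₁(1,1;1−βⱼ)·Σ_{n∈𝒩(𝒬),n<T}χ(n)τ₂(n)ϖ₁ⱼ(n)/n = 𝔞φ(D)/D + O(𝓛⁻³)`; derived here with `O(1/𝓛)`.
[cite: Zhang2022LandauSiegel, §15 p.88] -/
theorem u056_rate1_of_exists_calU1R_rel (c' : ℝ)
    (h50 : Section15C.Step15_u050 c' Section15C.inputs15AB)
    (h152 : Section15C.Lemma152 c' Section15C.inputs15AB)
    (hex : ForAllLarge fun D _ χ => AssumptionA D χ → ∀ j ∈ ({1, 2, 3} : Finset ℕ),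
      ∃ U : ℂ → ℂ, Section15C.IsCalU1R c' Section15C.inputs15AB χ j U)
    (h53 : Section15C.Step15_u053R c' Section15C.inputs15AB)
    (h55 : Section15C.Step15_u055Rel c' Section15C.inputs15AB)
    (h35 : Section15B.Step15_u035 c') :
    ∃ C : ℝ, ForAllLarge fun D _ χ => AssumptionA D χ → ∀ j ∈ ({1, 2, 3} : Finset ℕ),
      ‖Section15C.inputs15AB.calM1 c' χ 1 1 (1 - betaJ c' D j) *
          Section15C.sumInN c' Section15C.inputs15AB χ j -
        (frakA χ : ℂ) * (Nat.totient D : ℂ) / (D : ℂ)‖ ≤ C / ell D := by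
  obtain ⟨C₅, h50⟩ := h50
  obtain ⟨C₁, h152⟩ := h152
  have h153a := hex
  obtain ⟨C₃, h153b⟩ := h53
  obtain ⟨C₄, h55⟩ := h55
  obtain ⟨c₆, C₆, h35⟩ := h35
  set C₂ : ℝ := 1 + |C₃| * π with hC₂
  have hC₂0 : 0 ≤ C₂ := by rw [hC₂]; positivity
  set M : ℝ := max 3 (14 * |c'| * π + 1) with hM
  have hT : ForAllLarge fun D _ _ => M ≤ ell D :=
    ForAllLarge.of_le ⌈Real.exp M⌉₊ fun D _ _ hD _ _ => le_ell_of_ceil_exp_le₆ hD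
  -- the new u055 constant: `|C₆|·ε₄ ≤ K₄/𝓛`
  set K₄ : ℝ := |C₆| * |C₄| * π * ((1 + 4 * Real.exp (9 / 2)) ^ 2 * C₂ + 1) with hK₄
  set K : ℝ := |C₆| * |C₅| + K₄ +
    (4 * Real.exp (9 / 2)) ^ 2 * π * (|C₆| * |C₃| + |C₁| * (C₂ + |C₃| * π)) with hK
  obtain ⟨D₀, h⟩ := (((((h50.and h152).and h153a).and h153b).and h55).and h35).and hT
  refine ⟨K, D₀, fun D _ χ hD hq hp hA j hj => ?_⟩
  obtain ⟨⟨⟨⟨⟨⟨g50, g152⟩, g153a⟩, g153b⟩, g55⟩, g35⟩, hMℓ⟩ := h D χ hD hq hp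
  have hℓ3 : 3 ≤ ell D := (le_max_left _ _).trans hMℓ
  have hℓc : 14 * |c'| * π + 1 ≤ ell D := (le_max_right _ _).trans hMℓ
  have hℓ1 : 1 ≤ ell D := by linarith
  have hℓ0 : 0 < ell D := by linarith
  have hD3 : 3 ≤ D := by
    by_contra hlt
    have : (D : ℝ) < 3 := by exact_mod_cast not_le.mp hlt
    have hD0 : 0 < (D : ℝ) := by exact_mod_cast Nat.pos_of_ne_zero (NeZero.ne D)
    have : ell D < 3 := by
      calc ell D = Real.log D := rfl
        _ < Real.log (Real.exp 3) := Real.log_lt_log hD0 (by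
            have := Real.add_one_le_exp (3:ℝ); linarith)
        _ = 3 := Real.log_exp 3
    linarith
  have hα : alpha D = π / ell D ^ 9 := by rw [alpha, bigP, Real.log_exp]
  have hαpos : 0 < alpha D := by rw [hα]; positivity
  have hα1 : alpha D * ell D = π / ell D ^ 8 := by rw [hα]; field_simp
  have hαℓle : alpha D * ell D ≤ π := by
    rw [hα1]; exact div_le_self Real.pi_pos.le (one_le_pow₀ hℓ1)
  have hθ : |c' * alpha D * ell D| ≤ 1 / 14 := by
    rw [abs_mul, abs_mul, abs_of_pos hαpos, abs_of_pos hℓ0, mul_assoc, hα1,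
      show |c'| * (π / ell D ^ 8) = |c'| * π / ell D ^ 8 by ring,
      div_le_div_iff₀ (by positivity) (by norm_num)]
    have h8 : ell D ≤ ell D ^ 8 := by
      calc ell D = ell D ^ 1 := (pow_one _).symm
        _ ≤ ell D ^ 8 := pow_le_pow_right₀ hℓ1 (by norm_num)
    nlinarith [abs_nonneg c', Real.pi_pos]
  obtain ⟨hβ5, hβre⟩ := betaJ_norm_lt c' hαpos hθ hj
  set s : ℂ := 1 - betaJ c' D j with hs
  have hs1 : ‖s - 1‖ < 5 * alpha D := by rw [hs, sub_sub_cancel_left, norm_neg]; exact hβ5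
  have hsre : 9 / 10 < s.re := by rw [hs, Complex.sub_re, Complex.one_re, hβre]; norm_num
  have e152 : ‖Section15C.inputs15AB.calM1 c' χ 1 1 s - Section15C.eulerM1 χ‖ ≤
      C₁ * (alpha D * ell D) := g152 hA s hs1
  obtain ⟨U, hU⟩ := g153a hA j hj
  have e153b : ‖U 1 - (Nat.totient D : ℂ) ^ 2 / (D : ℂ) ^ 2 * Section15C.eulerU1 χ‖ ≤
      C₃ * (alpha D * ell D) := g153b hA j hj U hU
  have e55 : ‖Section15C.sumLtT c' Section15C.inputs15AB χ j - deriv χ.LFunction 1 ^ 2 * U 1‖ ≤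
      C₄ * (alpha D * ell D ^ (1.1 : ℝ)) * ((1 + ‖deriv χ.LFunction 1‖) ^ 2 * ‖U 1‖ + 1) :=
    g55 hA j hj U hU
  have e50 : ‖Section15C.sumNotInN c' Section15C.inputs15AB χ j‖ ≤ C₅ / ell D := g50 hA j hj
  have e35 : ‖Section15C.inputs15AB.calM1 c' χ 1 1 s‖ ≤ C₆ := by
    have h := g35 hA 1 1 le_rfl le_rfl s hsre
    rw [Section15C.inputs15AB_calM1]
    simpa using h
  have hαℓ0' : 0 ≤ alpha D * ell D := mul_nonneg hαpos.le hℓ0.le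
  have eU1 : ‖U 1‖ ≤ C₂ := by
    rw [hC₂]
    exact norm_U1_le' e153b hαℓ0' hαℓle (norm_totient_sq_div_sq_le_one' D)
      (norm_eulerU1_le_one χ)
  have hLup : ‖deriv χ.LFunction 1‖ ≤ 4 * Real.exp (9 / 2) * ell D ^ 2 := by
    have h := Lemma31.norm_deriv_LFunction_le_near_one χ (by rw [ell] at hℓ3; exact hℓ3) hp
      (w := 1) (by simp; positivity)
    calc ‖deriv χ.LFunction 1‖ ≤ 2 * Real.exp (9 / 2) * (1 + Real.log D) * Real.log D := h
      _ ≤ 2 * Real.exp (9 / 2) * (ell D + ell D) * ell D := by rw [ell] at hℓ1 ⊢; gcongr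
      _ = 4 * Real.exp (9 / 2) * ell D ^ 2 := by ring
  -- the relative u055 error as a number `ε₄ ≥ 0`
  set ε₄ : ℝ := |C₄| * (alpha D * ell D ^ (1.1 : ℝ)) *
    ((1 + ‖deriv χ.LFunction 1‖) ^ 2 * ‖U 1‖ + 1) with hε₄
  have hαℓ11 : 0 ≤ alpha D * ell D ^ (1.1 : ℝ) :=
    mul_nonneg hαpos.le (Real.rpow_nonneg hℓ0.le _)
  have e55' : ‖Section15C.sumLtT c' Section15C.inputs15AB χ j - deriv χ.LFunction 1 ^ 2 * U 1‖ ≤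
      ε₄ := e55.trans (by rw [hε₄]; gcongr; exact le_abs_self C₄)
  have hmain := mainTerm_u056 χ hp hq hD3
  have hP := u056_pointwise (ε₁ := |C₁| * (alpha D * ell D)) (ε₃ := |C₃| * (alpha D * ell D))
    (ε₄ := ε₄) (ε₅ := |C₅| / ell D) (C₂ := C₂) (C₆ := |C₆|)
    (e152.trans (by gcongr; exact le_abs_self C₁)) (e153b.trans (by gcongr; exact le_abs_self C₃))
    e55' (e50.trans (by gcongr; exact le_abs_self C₅))
    (e35.trans (le_abs_self C₆)) eU1 hLup hmain
  have hIn : Section15C.sumInN c' Section15C.inputs15AB χ j =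
      Section15C.sumLtT c' Section15C.inputs15AB χ j -
        Section15C.sumNotInN c' Section15C.inputs15AB χ j := by
    rw [sumLtT_eq]; ring
  rw [hIn]
  refine hP.trans ?_
  have t1 : |C₆| * (|C₅| / ell D) = |C₆| * |C₅| * (1 / ell D) := by ring
  -- `|C₆|·ε₄ ≤ K₄/𝓛` (the arithmetic is `relErr_le`)
  have t2 : |C₆| * ε₄ ≤ K₄ * (1 / ell D) := by
    rw [hε₄, hK₄]
    exact relErr_le hℓ1 hα hLup (norm_nonneg _) eU1 (norm_nonneg _)
  have t3 := t3_le (C₁ := C₁) (C₂ := C₂) (C₃ := C₃) (C₆ := C₆) hℓ1 hα1 hαℓle hαℓ0' hC₂0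
  have hKd : K / ell D = K * (1 / ell D) := div_eq_mul_one_div _ _
  rw [hKd, hK]
  linarith

/-- **u056 at the rate `O(1/𝓛)` over `Lemma153Rp` and the RELATIVE u055** (`Step15_u055Rel`): the
one-for-one twin of `u056_rate1_of_partsRp` for the re-typed leaf. [cite: Zhang2022LandauSiegel, §15 p.88] -/
theorem u056_rate1_of_partsRel (c' : ℝ) (h50 : Section15C.Step15_u050 c' Section15C.inputs15AB)
    (h152 : Section15C.Lemma152 c' Section15C.inputs15AB)
    (h153 : Section15C.Lemma153Rp c' Section15C.inputs15AB)
    (h55 : Section15C.Step15_u055Rel c' Section15C.inputs15AB)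
    (h35 : Section15B.Step15_u035 c') :
    ∃ C : ℝ, ForAllLarge fun D _ χ => AssumptionA D χ → ∀ j ∈ ({1, 2, 3} : Finset ℕ),
      ‖Section15C.inputs15AB.calM1 c' χ 1 1 (1 - betaJ c' D j) *
          Section15C.sumInN c' Section15C.inputs15AB χ j -
        (frakA χ : ℂ) * (Nat.totient D : ℂ) / (D : ℂ)‖ ≤ C / ell D := by
  obtain ⟨⟨C, D₀, hC⟩, h53⟩ := h153
  refine u056_rate1_of_exists_calU1R_rel c' h50 h152 ⟨D₀, fun D _ χ hD hq hp hA j hj => ?_⟩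
    h53 h55 h35
  obtain ⟨U, hU, -⟩ := hC D χ hD hq hp hA j hj
  exact ⟨U, hU⟩

/-- (15.23) in its repaired reading `Eq15_23R` (`O(1/𝓛)`) from (15.22), u050, Lemma 15.2,
`Lemma153Rp`, the RELATIVE u055 and u035. [cite: Zhang2022LandauSiegel, §15 (15.23) p.88] -/
theorem eq15_23R_of_partsRel (c' : ℝ)
    (h22 : Section15C.Eq15_22 c' Section15C.inputs15AB)
    (h50 : Section15C.Step15_u050 c' Section15C.inputs15AB)
    (h152 : Section15C.Lemma152 c' Section15C.inputs15AB)
    (h153 : Section15C.Lemma153Rp c' Section15C.inputs15AB)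
    (h55 : Section15C.Step15_u055Rel c' Section15C.inputs15AB)
    (h35 : Section15B.Step15_u035 c') : Section15C.Eq15_23R c' Section15C.inputs15AB :=
  eq15_23R_of_eq15_22_rate1 c' _ h22 (u056_rate1_of_partsRel c' h50 h152 h153 h55 h35)

/-- **(15.24) / `Skeleton.Ded1524 c′` — display list over the dischargeable readings with the
RELATIVE u055**: (15.6), (15.17), (15.22), u050, Lemma 15.2, `Lemma153RpI`, u055Rel, u035, u058, u059.
[cite: Zhang2022LandauSiegel, §15 (15.24) p.88] -/
theorem ded1524_of_displays_Rel (c' : ℝ) (h6 : Section15A.Eq15_6 c' Section15A.bLit)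
    (h17 : Section15B.Eq15_17 c' Section15A.bLit)
    (h22 : Section15C.Eq15_22 c' Section15C.inputs15AB)
    (h50 : Section15C.Step15_u050 c' Section15C.inputs15AB)
    (h152 : Section15C.Lemma152 c' Section15C.inputs15AB)
    (h153 : Section15C.Lemma153RpI c')
    (h55 : Section15C.Step15_u055Rel c' Section15C.inputs15AB)
    (h35 : Section15B.Step15_u035 c')
    (h58 : Section15C.Step15_u058 c' Section15C.inputs15AB)
    (h59 : Section15C.Step15_u059 c' Section15C.inputs15AB) : Ded1524 c' :=
  fun _ _ _ _ => eval1524_of_rates_R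
    (Φp := fun D _ χ p => Section15A.Phi1pOf c' χ (Section15A.bLit D χ) p)
    (S := fun D _ χ j => Section15B.calS1 c' χ (Section15A.bLit D χ) j)
    (R := fun _ _ χ j => Section15B.calR1 c' χ j)
    (Rs := fun _ _ χ => Section15A.calR1star c' χ)
    h6 h17 (eq15_23R_of_partsRel c' h22 h50 h152 h153 h55 h35)
    (prod_rate5_of_values c' h58 h59)

end Literature.NumberTheory.LFunctions.Zhang2022.Ded1524
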